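import Literature.Analysis.FluidPDE.SpaceTimeMollifier
import Literature.Analysis.FluidPDE.LocalLeraySlabPairing
import Literature.Analysis.FluidPDE.MollifiedLerayDistributional
import Literature.Analysis.FluidPDE.SpaceTimeCalculusC1
import Literature.Analysis.FluidPDE.PeriodicLerayLimitWeakForm
import Literature.Analysis.FluidPDE.PeriodicLerayGalerkinSystem
import Mathlib.Analysis.Calculus.BumpFunction.Convolution
import Mathlib.Analysis.Calculus.BumpFunction.FiniteDimension
import Mathlib.Analysis.Calculus.ContDiff.Convolution
import HarnessLib

/-!
# [BT1] weak formulation of the mollified perturbed Leray system on the line: the very weak form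
  and the Stokes form

Analysis/FluidPDE proof file (theorems only; no definitions, no named facts) in the DAG below the
named fact `Literature.Analysis.FluidPDE.bradshawTsai2017_thm_2_4_mollified`
(`PeriodicLerayExistence.lean`; Bradshaw–Tsai, Ann. Henri Poincaré 18 (2017) = arXiv:1510.07504
[BT1], Lemma 2.6 and the first part of the proof of Thm 2.4).

## Contents

First instalment: identities moving derivatives between the unknown and the test field in the
space–time (line) form of the weak formulation (time over `ℝ`, tests compactly supported in
`ℝ × ℝ³`), used to pass between clause (iii) of `IsMollifiedPeriodicWeakSolution` and the very
weak / Stokes forms of the system consumed by `BradshawTsai2017.distributional_of_veryWeak_slices`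
(`MollifiedLerayDistributional`) and by the local energy equality of distributional Stokes
solutions (`StokesLocalEnergyEquality`).

* `fderiv_normed_convolution_apply`, `exists_smooth_approx_fderiv` — `C¹_c` functions on `ℝ × E`
  are approximated by smooth ones together with their derivatives, supports in a fixed compact;
* `integral_inner_gradient_eq_zero_of_contDiff_one` — weak divergence-freeness (tested with
  smooth space–time tests) extends to `C¹_c` tests;
* `integral_inner_convect_profile_eq_neg` — `∫∫ ⟪W, (u·∇)ψ⟫ = -∫∫ ⟪DW u, ψ⟫` for a weakly
  divergence-free `u` and a `C¹` profile `W` (the term `u·∇W` of the perturbed Leray system);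
* `IsSpaceTimeTestOn.exists_ball_space` — uniform-in-time spatial support of a test field;
* `BradshawTsai2017.integral_lerayPairing_eq_neg` — the profile pairing `⟨LW(s), ψ(s)⟩`
  integrated over the time line, all derivatives moved onto `ψ`.

## References

* Z. Bradshaw, T.-P. Tsai, Ann. Henri Poincaré 18 (2017) = arXiv:1510.07504, §2
  [BradshawTsai2017AHP].
* L. C. Evans, *Partial Differential Equations* (2010), §5.2–§5.3, App. C.4. [Evans2010]
-/

noncomputable section

open MeasureTheory Set Function Filter Topology TopologicalSpace Metric ContinuousLinearMap
open scoped NNReal ENNReal InnerProductSpace RealInnerProductSpace ContDiff Convolution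

namespace Literature.Analysis.FluidPDE

/-! ### Weak divergence-freeness against `C¹` test functions -/

section C1Extension

variable {E : Type*} [NormedAddCommGroup E] [InnerProductSpace ℝ E] [FiniteDimensional ℝ E]
  [MeasurableSpace E] [BorelSpace E]

/-- **Differentiating under a bump mollification, directionally**: for `g ∈ C¹_c` and a normed
bump `φ`, `D(φ ⋆ g)(z) w = (φ ⋆ ∂_w g)(z)` (Mathlib's `HasCompactSupport.hasFDerivAt_convolution_right`,
evaluated at `w`). [cite: Evans2010, App. C.4 Thm. 7 (iv)] -/
theorem fderiv_normed_convolution_apply {X : Type*} [NormedAddCommGroup X] [NormedSpace ℝ X]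
    [FiniteDimensional ℝ X] [MeasurableSpace X] [BorelSpace X] [HasContDiffBump X]
    {μ : Measure X} [μ.IsAddHaarMeasure] (φ : ContDiffBump (0 : X)) {g : X → ℝ}
    (hg : ContDiff ℝ 1 g) (hgc : HasCompactSupport g) (z w : X) :
    fderiv ℝ (φ.normed μ ⋆[lsmul ℝ ℝ, μ] g) z w =
      (φ.normed μ ⋆[lsmul ℝ ℝ, μ] fun x => fderiv ℝ g x w) z := by
  have hf : LocallyIntegrable (φ.normed μ) μ := φ.integrable_normed.locallyIntegrable
  have hD := hgc.hasFDerivAt_convolution_right (lsmul ℝ ℝ) hf hg z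
  have hint : ConvolutionExistsAt (φ.normed μ) (fderiv ℝ g) z
      ((lsmul ℝ ℝ : ℝ →L[ℝ] ℝ →L[ℝ] ℝ).precompR X) μ :=
    (hgc.fderiv ℝ).convolutionExists_right _ hf (hg.continuous_fderiv one_ne_zero) z
  rw [hD.fderiv, convolution_def, ContinuousLinearMap.integral_apply hint.integrable w,
    convolution_def]
  simp only [precompR_apply, lsmul_apply, ContinuousLinearMap.compL_apply,
    ContinuousLinearMap.coe_comp, comp_apply, smul_eq_mul]

/-- **Mollifying a `C¹` compactly supported function approximates its directional derivatives
uniformly by those of a smooth compactly supported function supported in the unit thickening of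
its support.** [cite: Evans2010, App. C.4 Thm. 7 (iii)–(iv)] -/
theorem exists_smooth_approx_fderiv {g : ℝ × E → ℝ} (hg : ContDiff ℝ 1 g)
    (hgc : HasCompactSupport g) {ε : ℝ} (hε : 0 < ε) :
    ∃ θ : ℝ × E → ℝ, ContDiff ℝ (⊤ : ℕ∞) θ ∧ HasCompactSupport θ ∧
      tsupport θ ⊆ cthickening 1 (tsupport g) ∧
      ∀ z w, |fderiv ℝ θ z w - fderiv ℝ g z w| ≤ ε * ‖w‖ := by
  haveI : (volume : Measure (ℝ × E)).IsAddHaarMeasure := Measure.prod.instIsAddHaarMeasure _ _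
  have hDg : Continuous (fderiv ℝ g) := hg.continuous_fderiv one_ne_zero
  have hDgc : HasCompactSupport (fderiv ℝ g) := hgc.fderiv (𝕜 := ℝ)
  have huc : UniformContinuous (fderiv ℝ g) := hDgc.uniformContinuous_of_continuous hDg
  obtain ⟨δ, hδ, hδε⟩ := (Metric.uniformContinuous_iff (α := ℝ × E) (β := ℝ × E →L[ℝ] ℝ)).1
    huc ε hε
  -- a bump of radius `r ≤ min δ 1`
  set r : ℝ := min δ 1 / 2 with hr
  have hr0 : 0 < r := by positivity
  have hrδ : r < δ := by
    have : min δ 1 ≤ δ := min_le_left _ _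
    rw [hr]; linarith
  have hr1 : r < 1 := by
    have : min δ 1 ≤ 1 := min_le_right _ _
    rw [hr]; linarith
  let φ : ContDiffBump (0 : ℝ × E) := ⟨r / 2, r, by positivity, by linarith⟩
  have hφr : φ.rOut = r := rfl
  set θ : ℝ × E → ℝ := φ.normed volume ⋆[lsmul ℝ ℝ, volume] g with hθ
  have hgl : LocallyIntegrable g volume := hg.continuous.locallyIntegrable
  have hθs : ContDiff ℝ (⊤ : ℕ∞) θ :=
    φ.hasCompactSupport_normed.contDiff_convolution_left _ φ.contDiff_normed hgl
  have hθc : HasCompactSupport θ := φ.hasCompactSupport_normed.convolution _ hgc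
  -- support in the unit thickening
  have hsupp : tsupport θ ⊆ cthickening 1 (tsupport g) := by
    refine closure_minimal ?_ isClosed_cthickening
    intro z hz
    have h1 := support_convolution_subset (L := lsmul ℝ ℝ) (μ := volume) (f := φ.normed volume)
      (g := g) hz
    rw [φ.support_normed_eq] at h1
    obtain ⟨a, ha, b, hb, rfl⟩ := h1
    refine thickening_subset_cthickening 1 _ ?_
    rw [mem_thickening_iff]
    refine ⟨b, subset_tsupport _ hb, ?_⟩
    rw [mem_ball_zero_iff] at ha
    rw [dist_eq_norm, add_sub_cancel_right]
    linarith
  refine ⟨θ, hθs, hθc, hsupp, fun z w => ?_⟩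
  -- the directional derivative is the mollified directional derivative
  rw [hθ, fderiv_normed_convolution_apply φ hg hgc z w, ← Real.dist_eq]
  refine φ.dist_normed_convolution_le (hDg.clm_apply continuous_const).aestronglyMeasurable
    fun x hx => ?_
  rw [hφr] at hx
  have h1 : dist (fderiv ℝ g x) (fderiv ℝ g z) < ε := hδε (lt_trans (mem_ball.1 hx) hrδ)
  rw [Real.dist_eq]
  calc |fderiv ℝ g x w - fderiv ℝ g z w| = ‖(fderiv ℝ g x - fderiv ℝ g z) w‖ := by
        rw [sub_apply, Real.norm_eq_abs]
    _ ≤ ‖fderiv ℝ g x - fderiv ℝ g z‖ * ‖w‖ := le_opNorm _ _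
    _ ≤ ε * ‖w‖ := by
        refine mul_le_mul_of_nonneg_right ?_ (norm_nonneg _)
        exact (dist_eq_norm (fderiv ℝ g x) (fderiv ℝ g z)).symm.le.trans h1.le

/-- **Weak divergence-freeness extends to `C¹` test functions.** If `u` is locally integrable on
`ℝ × E` and `∫∫ ⟪u, ∇θ⟫ = 0` for every (smooth) space–time test function `θ`, then
`∫∫ ⟪u, ∇Θ⟫ = 0` for every `Θ ∈ C¹_c(ℝ × E)` (mollify `Θ`: the gradients converge uniformly with
supports in a fixed compact set). [cite: Evans2010, §5.2.1 and App. C.4 Thm. 7] -/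
theorem integral_inner_gradient_eq_zero_of_contDiff_one {u : ℝ → E → E}
    (hu : LocallyIntegrable (uncurry u) volume)
    (hdiv : ∀ θ : ℝ → E → ℝ, IsSpaceTimeTestOn (⊤ : Opens (ℝ × E)) θ →
      ∫ z : ℝ × E, ⟪u z.1 z.2, gradient (θ z.1) z.2⟫ = 0)
    {Θ : ℝ → E → ℝ} (hΘ : ContDiff ℝ 1 (uncurry Θ)) (hΘc : HasCompactSupport (uncurry Θ)) :
    ∫ z : ℝ × E, ⟪u z.1 z.2, gradient (Θ z.1) z.2⟫ = 0 := by
  set g : ℝ × E → ℝ := uncurry Θ with hgdef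
  set K : Set (ℝ × E) := cthickening 1 (tsupport g) with hKdef
  have hK : IsCompact K := hΘc.isCompact.cthickening
  have huK : IntegrableOn (uncurry u) K volume := hu.integrableOn_isCompact hK
  set C : ℝ := ∫ z in K, ‖uncurry u z‖ with hCdef
  have hC0 : 0 ≤ C := integral_nonneg fun z => norm_nonneg _
  have hgK : tsupport g ⊆ K := self_subset_cthickening _
  -- the norm of `(0, u)` in `ℝ × E`
  have hnorm : ∀ z : ℝ × E, ‖((0 : ℝ), u z.1 z.2)‖ = ‖uncurry u z‖ := fun z => by
    rw [Prod.norm_mk, norm_zero, max_eq_right (norm_nonneg _)]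
    rfl
  -- `⟪u, ∇(slice)⟫ = D(·)(0, u)`
  have hslice : ∀ {h : ℝ × E → ℝ}, Differentiable ℝ h → ∀ z : ℝ × E,
      ⟪u z.1 z.2, gradient (fun y => h (z.1, y)) z.2⟫ = fderiv ℝ h z ((0 : ℝ), u z.1 z.2) := by
    intro h hh z
    rw [real_inner_comm, gradient, InnerProductSpace.toDual_symm_apply,
      fderiv_slice_apply (hh z)]
  -- the bound for every `ε > 0`
  have hbound : ∀ ε : ℝ, 0 < ε → ‖∫ z : ℝ × E, ⟪u z.1 z.2, gradient (Θ z.1) z.2⟫‖ ≤ ε * C := by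
    intro ε hε
    obtain ⟨θ, hθs, hθc, hθK, hθε⟩ := exists_smooth_approx_fderiv hΘ hΘc hε
    have hθtest : IsSpaceTimeTestOn (⊤ : Opens (ℝ × E)) (curry θ) := ⟨hθs, hθc, by simp⟩
    have h0 := hdiv (curry θ) hθtest
    have hgd : Differentiable ℝ g := hΘ.differentiable one_ne_zero
    have hθd : Differentiable ℝ θ := hθs.differentiable (by simp)
    -- the difference integrand, pointwise
    have hpt : ∀ z : ℝ × E, ⟪u z.1 z.2, gradient (Θ z.1) z.2⟫ -
        ⟪u z.1 z.2, gradient (curry θ z.1) z.2⟫ =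
        (fderiv ℝ g z - fderiv ℝ θ z) ((0 : ℝ), u z.1 z.2) := by
      intro z
      have e1 : ⟪u z.1 z.2, gradient (Θ z.1) z.2⟫ = fderiv ℝ g z ((0 : ℝ), u z.1 z.2) :=
        hslice hgd z
      have e2 : ⟪u z.1 z.2, gradient (curry θ z.1) z.2⟫ = fderiv ℝ θ z ((0 : ℝ), u z.1 z.2) :=
        hslice hθd z
      rw [e1, e2, sub_apply]
    -- integrability of the two pairings
    have hint : ∀ {h : ℝ × E → ℝ}, ContDiff ℝ 1 h → HasCompactSupport h → tsupport h ⊆ K →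
        Integrable (fun z : ℝ × E => fderiv ℝ h z ((0 : ℝ), u z.1 z.2)) volume ∧
        ∀ z ∉ K, fderiv ℝ h z ((0 : ℝ), u z.1 z.2) = 0 := by
      intro h hh hhc hhK
      have hzero : ∀ z ∉ K, fderiv ℝ h z ((0 : ℝ), u z.1 z.2) = 0 := fun z hz => by
        rw [fderiv_of_notMem_tsupport ℝ (fun h' => hz (hhK h'))]
        rfl
      refine ⟨?_, hzero⟩
      have hsupp : support (fun z : ℝ × E => fderiv ℝ h z ((0 : ℝ), u z.1 z.2)) ⊆ K := by
        intro z hz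
        by_contra hzK
        exact hz (hzero z hzK)
      refine (integrableOn_iff_integrable_of_support_subset hsupp).1 ?_
      obtain ⟨M, hM⟩ := (hh.continuous_fderiv one_ne_zero).bounded_above_of_compact_support
        (hhc.fderiv (𝕜 := ℝ))
      have hmeas : AEStronglyMeasurable (fun z : ℝ × E => fderiv ℝ h z ((0 : ℝ), u z.1 z.2))
          (volume.restrict K) :=
        isBoundedBilinearMap_apply.continuous.comp_aestronglyMeasurable
          ((hh.continuous_fderiv one_ne_zero).aestronglyMeasurable.prodMk
            ((continuous_const.prodMk continuous_id).comp_aestronglyMeasurable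
              huK.aestronglyMeasurable))
      refine Integrable.mono' (huK.norm.const_mul M) hmeas ?_
      filter_upwards with z
      calc ‖fderiv ℝ h z ((0 : ℝ), u z.1 z.2)‖ ≤ ‖fderiv ℝ h z‖ * ‖((0 : ℝ), u z.1 z.2)‖ :=
            le_opNorm _ _
        _ ≤ M * ‖uncurry u z‖ := by
            rw [hnorm z]
            exact mul_le_mul_of_nonneg_right (hM z) (norm_nonneg _)
    obtain ⟨ig, hg0⟩ := hint hΘ hΘc hgK
    obtain ⟨iθ, hθ0⟩ := hint (hθs.of_le (by exact_mod_cast le_top)) hθc hθK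
    -- rewrite the target integral as the integral of the difference
    have e : ∫ z : ℝ × E, ⟪u z.1 z.2, gradient (Θ z.1) z.2⟫ =
        ∫ z : ℝ × E, (fderiv ℝ g z - fderiv ℝ θ z) ((0 : ℝ), u z.1 z.2) := by
      have h1 : ∫ z : ℝ × E, ⟪u z.1 z.2, gradient (Θ z.1) z.2⟫ =
          ∫ z : ℝ × E, fderiv ℝ g z ((0 : ℝ), u z.1 z.2) :=
        integral_congr_ae (ae_of_all _ fun z => hslice hgd z)
      have h2 : ∫ z : ℝ × E, ⟪u z.1 z.2, gradient (curry θ z.1) z.2⟫ =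
          ∫ z : ℝ × E, fderiv ℝ θ z ((0 : ℝ), u z.1 z.2) :=
        integral_congr_ae (ae_of_all _ fun z => hslice hθd z)
      rw [h2] at h0
      simp only [sub_apply]
      rw [integral_sub ig iθ, h0, sub_zero, h1]
    rw [e]
    -- bound by `ε ∫_K |u|`
    have hle : ∀ z : ℝ × E, ‖(fderiv ℝ g z - fderiv ℝ θ z) ((0 : ℝ), u z.1 z.2)‖ ≤
        K.indicator (fun z => ε * ‖uncurry u z‖) z := by
      intro z
      by_cases hz : z ∈ K
      · rw [indicator_of_mem hz]
        calc ‖(fderiv ℝ g z - fderiv ℝ θ z) ((0 : ℝ), u z.1 z.2)‖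
            = |fderiv ℝ θ z ((0 : ℝ), u z.1 z.2) - fderiv ℝ g z ((0 : ℝ), u z.1 z.2)| := by
              rw [sub_apply, Real.norm_eq_abs, abs_sub_comm]
          _ ≤ ε * ‖((0 : ℝ), u z.1 z.2)‖ := hθε z _
          _ = ε * ‖uncurry u z‖ := by rw [hnorm z]
      · rw [indicator_of_notMem hz, sub_apply, hg0 z hz, hθ0 z hz, sub_zero,
          norm_zero]
    calc ‖∫ z : ℝ × E, (fderiv ℝ g z - fderiv ℝ θ z) ((0 : ℝ), u z.1 z.2)‖
        ≤ ∫ z : ℝ × E, K.indicator (fun z => ε * ‖uncurry u z‖) z :=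
          norm_integral_le_of_norm_le (IntegrableOn.integrable_indicator
            (huK.norm.const_mul ε) hK.measurableSet) (ae_of_all _ hle)
      _ = ε * C := by rw [integral_indicator hK.measurableSet, integral_const_mul]
  -- conclusion: `‖I‖ ≤ ε C` for all `ε > 0`
  by_contra hne
  have hI : 0 < ‖∫ z : ℝ × E, ⟪u z.1 z.2, gradient (Θ z.1) z.2⟫‖ := norm_pos_iff.2 hne
  have h := hbound (‖∫ z : ℝ × E, ⟪u z.1 z.2, gradient (Θ z.1) z.2⟫‖ / (2 * (C + 1)))
    (by positivity)
  have hC1 : 0 < C + 1 := by linarith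
  have : ‖∫ z : ℝ × E, ⟪u z.1 z.2, gradient (Θ z.1) z.2⟫‖ / (2 * (C + 1)) * C <
      ‖∫ z : ℝ × E, ⟪u z.1 z.2, gradient (Θ z.1) z.2⟫‖ := by
    rw [div_mul_eq_mul_div, div_lt_iff₀ (by positivity)]
    nlinarith
  linarith

end C1Extension

/-! ### The profile term: `∫∫ ⟪W, (u·∇)ψ⟫ = -∫∫ ⟪DW u, ψ⟫` for weakly divergence-free `u` -/

section Profile

variable {E : Type*} [NormedAddCommGroup E] [InnerProductSpace ℝ E] [FiniteDimensional ℝ E]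
  [MeasurableSpace E] [BorelSpace E]

/-- **`∫∫ ⟪W, (u·∇)ψ⟫ = -∫∫ ⟪DW u, ψ⟫`** for a locally integrable, weakly divergence-free `u`
on `ℝ × E`, a `C¹` profile `W` and a test field `ψ`: weak divergence-freeness tested with the
`C¹` compactly supported scalar `⟪W, ψ⟫`, whose gradient pairs with `u` as
`⟪u, ∇⟪W, ψ⟫⟫ = ⟪DW u, ψ⟫ + ⟪W, Dψ u⟫` (the term `u·∇W` of the perturbed Leray system moved onto
the test field; Bradshaw–Tsai 2017, §2, weak formulation). [cite: BradshawTsai2017AHP, §2 (weak formulation of the perturbed Leray system)] -/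
theorem integral_inner_convect_profile_eq_neg {u W : ℝ → E → E}
    (hu : LocallyIntegrable (uncurry u) volume)
    (hdiv : ∀ θ : ℝ → E → ℝ, IsSpaceTimeTestOn (⊤ : Opens (ℝ × E)) θ →
      ∫ z : ℝ × E, ⟪u z.1 z.2, gradient (θ z.1) z.2⟫ = 0)
    (hW : ContDiff ℝ 1 (uncurry W)) {ψ : ℝ → E → E}
    (hψ : IsSpaceTimeTestOn (⊤ : Opens (ℝ × E)) ψ) :
    ∫ z : ℝ × E, ⟪W z.1 z.2, fderiv ℝ (ψ z.1) z.2 (u z.1 z.2)⟫ =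
      -∫ z : ℝ × E, ⟪fderiv ℝ (W z.1) z.2 (u z.1 z.2), ψ z.1 z.2⟫ := by
  -- the `C¹` compactly supported scalar `Θ = ⟪W, ψ⟫`
  set Θ : ℝ → E → ℝ := fun s y => ⟪W s y, ψ s y⟫ with hΘdef
  have hΘ1 : ContDiff ℝ 1 (uncurry Θ) :=
    hW.inner ℝ (hψ.contDiff.of_le (by exact_mod_cast le_top))
  have hK : IsCompact (tsupport (uncurry ψ)) := hψ.hasCompactSupport
  have hψ0 : ∀ z : ℝ × E, z ∉ tsupport (uncurry ψ) → ψ z.1 z.2 = 0 ∧ fderiv ℝ (ψ z.1) z.2 = 0 :=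
    fun z hz => ⟨(image_eq_zero_of_notMem_tsupport hz : uncurry ψ z = 0),
      IsSpaceTimeTestOn.fderiv_slice_eq_zero_of_notMem hz⟩
  have hΘc : HasCompactSupport (uncurry Θ) := by
    refine HasCompactSupport.intro hK fun z hz => ?_
    show ⟪W z.1 z.2, ψ z.1 z.2⟫ = 0
    rw [(hψ0 z hz).1, inner_zero_right]
  -- its slice gradient paired with `u`
  have hWd : ∀ s, Differentiable ℝ (W s) := fun s =>
    (hW.comp (contDiff_prodMk_right s)).differentiable one_ne_zero
  have hψd : ∀ s, Differentiable ℝ (ψ s) := fun s =>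
    (hψ.contDiff_slice s).differentiable (by simp)
  have hgrad : ∀ z : ℝ × E, ⟪u z.1 z.2, gradient (Θ z.1) z.2⟫ =
      ⟪fderiv ℝ (W z.1) z.2 (u z.1 z.2), ψ z.1 z.2⟫ +
        ⟪W z.1 z.2, fderiv ℝ (ψ z.1) z.2 (u z.1 z.2)⟫ := by
    intro z
    rw [real_inner_comm, gradient, InnerProductSpace.toDual_symm_apply]
    show fderiv ℝ (fun y => ⟪W z.1 y, ψ z.1 y⟫) z.2 (u z.1 z.2) = _
    rw [fderiv_inner_apply ℝ (hWd z.1 z.2) (hψd z.1 z.2)]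
    simp only [real_inner_comm]
    ring
  -- integrability of the two pairings
  have hKQ : tsupport (uncurry ψ) ⊆ ((⊤ : Opens (ℝ × E)) : Set (ℝ × E)) := fun _ _ => trivial
  have cDW : Continuous fun z : ℝ × E => fderiv ℝ (W z.1) z.2 := by
    have h := continuousOn_fderiv_slice_of_contDiffOn (w := W) (S := (univ : Set ℝ))
      (by rw [univ_prod_univ]; exact hW.contDiffOn) uniqueDiffOn_univ
    rw [univ_prod_univ] at h
    exact continuousOn_univ.1 h
  have cDψ : Continuous fun z : ℝ × E => fderiv ℝ (ψ z.1) z.2 := hψ.fderiv_top.contDiff.continuous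
  have cW : Continuous fun z : ℝ × E => W z.1 z.2 := hW.continuous
  have cψ : Continuous fun z : ℝ × E => ψ z.1 z.2 := hψ.contDiff.continuous
  have huK : IntegrableOn (uncurry u) (tsupport (uncurry ψ)) volume := hu.integrableOn_isCompact hK
  have i1 : Integrable (fun z : ℝ × E => ⟪fderiv ℝ (W z.1) z.2 (u z.1 z.2), ψ z.1 z.2⟫) volume := by
    -- `⟪DW u, ψ⟫ = ⟪u, (DW)ᵀ ψ⟫`: bound by `‖DW‖ ‖ψ‖ |u|` on the support
    have hsupp : support (fun z : ℝ × E => ⟪fderiv ℝ (W z.1) z.2 (u z.1 z.2), ψ z.1 z.2⟫) ⊆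
        tsupport (uncurry ψ) := by
      intro z hz
      by_contra h
      exact hz (by simp [(hψ0 z h).1])
    refine (integrableOn_iff_integrable_of_support_subset hsupp).1 ?_
    obtain ⟨C, hC⟩ := hK.exists_bound_of_continuousOn (f := fun z : ℝ × E =>
      ‖fderiv ℝ (W z.1) z.2‖ * ‖ψ z.1 z.2‖) ((cDW.norm.mul cψ.norm).continuousOn)
    have hmeas : AEStronglyMeasurable
        (fun z : ℝ × E => ⟪fderiv ℝ (W z.1) z.2 (u z.1 z.2), ψ z.1 z.2⟫)
        (volume.restrict (tsupport (uncurry ψ))) :=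
      (isBoundedBilinearMap_apply.continuous.comp_aestronglyMeasurable
        (cDW.aestronglyMeasurable.restrict.prodMk huK.aestronglyMeasurable)).inner
        cψ.aestronglyMeasurable.restrict
    refine Integrable.mono' (huK.norm.const_mul C) hmeas ?_
    filter_upwards [ae_restrict_mem hK.measurableSet] with z hz
    calc ‖⟪fderiv ℝ (W z.1) z.2 (u z.1 z.2), ψ z.1 z.2⟫‖
        ≤ ‖fderiv ℝ (W z.1) z.2 (u z.1 z.2)‖ * ‖ψ z.1 z.2‖ := norm_inner_le_norm _ _
      _ ≤ (‖fderiv ℝ (W z.1) z.2‖ * ‖u z.1 z.2‖) * ‖ψ z.1 z.2‖ :=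
          mul_le_mul_of_nonneg_right (le_opNorm _ _) (norm_nonneg _)
      _ = (‖fderiv ℝ (W z.1) z.2‖ * ‖ψ z.1 z.2‖) * ‖uncurry u z‖ := by
          simp only [uncurry]; ring
      _ ≤ C * ‖uncurry u z‖ := by
          refine mul_le_mul_of_nonneg_right ?_ (norm_nonneg _)
          have h := hC z hz
          rw [Real.norm_eq_abs, abs_of_nonneg (by positivity)] at h
          exact h
  have i2 : Integrable (fun z : ℝ × E => ⟪W z.1 z.2, fderiv ℝ (ψ z.1) z.2 (u z.1 z.2)⟫) volume := by
    have hsupp : support (fun z : ℝ × E => ⟪W z.1 z.2, fderiv ℝ (ψ z.1) z.2 (u z.1 z.2)⟫) ⊆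
        tsupport (uncurry ψ) := by
      intro z hz
      by_contra h
      exact hz (by simp [(hψ0 z h).2])
    refine (integrableOn_iff_integrable_of_support_subset hsupp).1 ?_
    obtain ⟨C, hC⟩ := hK.exists_bound_of_continuousOn (f := fun z : ℝ × E =>
      ‖W z.1 z.2‖ * ‖fderiv ℝ (ψ z.1) z.2‖) ((cW.norm.mul cDψ.norm).continuousOn)
    have hmeas : AEStronglyMeasurable
        (fun z : ℝ × E => ⟪W z.1 z.2, fderiv ℝ (ψ z.1) z.2 (u z.1 z.2)⟫)
        (volume.restrict (tsupport (uncurry ψ))) :=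
      cW.aestronglyMeasurable.restrict.inner
        (isBoundedBilinearMap_apply.continuous.comp_aestronglyMeasurable
          (cDψ.aestronglyMeasurable.restrict.prodMk huK.aestronglyMeasurable))
    refine Integrable.mono' (huK.norm.const_mul C) hmeas ?_
    filter_upwards [ae_restrict_mem hK.measurableSet] with z hz
    calc ‖⟪W z.1 z.2, fderiv ℝ (ψ z.1) z.2 (u z.1 z.2)⟫‖
        ≤ ‖W z.1 z.2‖ * ‖fderiv ℝ (ψ z.1) z.2 (u z.1 z.2)‖ := norm_inner_le_norm _ _
      _ ≤ ‖W z.1 z.2‖ * (‖fderiv ℝ (ψ z.1) z.2‖ * ‖u z.1 z.2‖) :=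
          mul_le_mul_of_nonneg_left (le_opNorm _ _) (norm_nonneg _)
      _ = (‖W z.1 z.2‖ * ‖fderiv ℝ (ψ z.1) z.2‖) * ‖uncurry u z‖ := by
          simp only [uncurry]; ring
      _ ≤ C * ‖uncurry u z‖ := by
          refine mul_le_mul_of_nonneg_right ?_ (norm_nonneg _)
          have h := hC z hz
          rw [Real.norm_eq_abs, abs_of_nonneg (by positivity)] at h
          exact h
  -- weak divergence-freeness against `Θ`
  have h0 := integral_inner_gradient_eq_zero_of_contDiff_one hu hdiv hΘ1 hΘc
  rw [integral_congr_ae (ae_of_all _ hgrad), integral_add i1 i2] at h0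
  linarith

end Profile

/-! ### The profile pairing integrated over the line -/

section LerayLine

variable {W : ℝ → EuclideanSpace ℝ (Fin 3) → EuclideanSpace ℝ (Fin 3)}

/-- A space–time test field on `ℝ × ℝ³` and its weights vanish outside a ball in space,
uniformly in time. [folklore] -/
theorem IsSpaceTimeTestOn.exists_ball_space {F' : Type*} [NormedAddCommGroup F']
    [NormedSpace ℝ F'] {ψ : ℝ → EuclideanSpace ℝ (Fin 3) → F'}
    (hψ : IsSpaceTimeTestOn (⊤ : Opens (ℝ × EuclideanSpace ℝ (Fin 3))) ψ) :
    ∃ R : ℝ, 0 < R ∧ ∀ s (y : EuclideanSpace ℝ (Fin 3)),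
      y ∉ ball (0 : EuclideanSpace ℝ (Fin 3)) R →
        ψ s y = 0 ∧ fderiv ℝ (ψ s) y = 0 ∧ timeDeriv ψ s y = 0 := by
  have h2 : IsCompact (Prod.snd '' tsupport (uncurry ψ)) := hψ.hasCompactSupport.image continuous_snd
  obtain ⟨R₀, hR₀⟩ := h2.isBounded.subset_closedBall (0 : EuclideanSpace ℝ (Fin 3))
  refine ⟨|R₀| + 1, by positivity, fun s y hy => ?_⟩
  have hout : (s, y) ∉ tsupport (uncurry ψ) := by
    intro hmem
    have hy' : y ∈ closedBall (0 : EuclideanSpace ℝ (Fin 3)) R₀ := hR₀ ⟨(s, y), hmem, rfl⟩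
    rw [mem_closedBall_zero_iff] at hy'
    rw [mem_ball_zero_iff, not_lt] at hy
    linarith [le_abs_self R₀]
  exact ⟨(image_eq_zero_of_notMem_tsupport hout : uncurry ψ (s, y) = 0),
    IsSpaceTimeTestOn.fderiv_slice_eq_zero_of_notMem hout,
    IsSpaceTimeTestOn.timeDeriv_eq_zero_of_notMem hout⟩

/-- **The profile pairing integrated over the line**: for a `C¹` profile `W` and a space–time
test field `ψ` on `ℝ × ℝ³`,
`∫_ℝ ⟨LW(s), ψ(s)⟩ ds = -∫∫ (⟪W, ∂ₛψ⟫ − DW : Dψ + ⟪W + (y·∇)W, ψ⟫)` — the accepted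
`lerayPairing_add_integral_eq` integrated in time, the total derivative
`d/ds ∫ ⟪W, ψ⟫ dy` integrating to zero over `ℝ` (compact time support). [cite: BradshawTsai2017AHP, §2 (the pairing ⟨LW, ζ⟩)] -/
theorem BradshawTsai2017.integral_lerayPairing_eq_neg (hW : ContDiff ℝ 1 (uncurry W))
    {ψ : ℝ → EuclideanSpace ℝ (Fin 3) → EuclideanSpace ℝ (Fin 3)}
    (hψ : IsSpaceTimeTestOn (⊤ : Opens (ℝ × EuclideanSpace ℝ (Fin 3))) ψ) :
    ∫ s, BradshawTsai2017.lerayPairing W s (ψ s) =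
      -∫ z : ℝ × EuclideanSpace ℝ (Fin 3), (⟪W z.1 z.2, timeDeriv ψ z.1 z.2⟫ -
        frobeniusInner (fderiv ℝ (W z.1) z.2) (fderiv ℝ (ψ z.1) z.2) +
        ⟪W z.1 z.2 + fderiv ℝ (W z.1) z.2 z.2, ψ z.1 z.2⟫) := by
  have hψ1 : ContDiff ℝ 1 (uncurry ψ) := hψ.contDiff.of_le (by exact_mod_cast le_top)
  obtain ⟨R, hR0, hR⟩ := hψ.exists_ball_space
  have happ : Continuous (uncurry fun (L : EuclideanSpace ℝ (Fin 3) →L[ℝ] EuclideanSpace ℝ (Fin 3))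
      (v : EuclideanSpace ℝ (Fin 3)) => L v) := isBoundedBilinearMap_apply.continuous
  -- the two continuous, compactly supported space–time integrands
  have cW : Continuous fun z : ℝ × EuclideanSpace ℝ (Fin 3) => W z.1 z.2 := hW.continuous
  have cWt : Continuous fun z : ℝ × EuclideanSpace ℝ (Fin 3) => timeDeriv W z.1 z.2 :=
    BradshawTsai2017.continuous_timeDeriv_of_contDiff_one hW
  have cDW : Continuous fun z : ℝ × EuclideanSpace ℝ (Fin 3) => fderiv ℝ (W z.1) z.2 :=
    BradshawTsai2017.continuous_fderiv_slice_of_contDiff hW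
  have cψ : Continuous fun z : ℝ × EuclideanSpace ℝ (Fin 3) => ψ z.1 z.2 := hψ1.continuous
  have cψt : Continuous fun z : ℝ × EuclideanSpace ℝ (Fin 3) => timeDeriv ψ z.1 z.2 :=
    BradshawTsai2017.continuous_timeDeriv_of_contDiff_one hψ1
  have cDψ : Continuous fun z : ℝ × EuclideanSpace ℝ (Fin 3) => fderiv ℝ (ψ z.1) z.2 :=
    BradshawTsai2017.continuous_fderiv_slice_of_contDiff hψ1
  set A : ℝ × EuclideanSpace ℝ (Fin 3) → ℝ := fun z => ⟪W z.1 z.2, timeDeriv ψ z.1 z.2⟫ -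
    frobeniusInner (fderiv ℝ (W z.1) z.2) (fderiv ℝ (ψ z.1) z.2) +
    ⟪W z.1 z.2 + fderiv ℝ (W z.1) z.2 z.2, ψ z.1 z.2⟫ with hA
  set B : ℝ × EuclideanSpace ℝ (Fin 3) → ℝ := fun z => ⟪W z.1 z.2, timeDeriv ψ z.1 z.2⟫ +
    ⟪timeDeriv W z.1 z.2, ψ z.1 z.2⟫ with hB
  have cA : Continuous A :=
    ((cW.inner cψt).sub (continuous_frobeniusInner_comp cDW cDψ)).add
      ((cW.add (happ.comp (cDW.prodMk continuous_snd))).inner cψ)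
  have cB : Continuous B := (cW.inner cψt).add (cWt.inner cψ)
  have hK : IsCompact (tsupport (uncurry ψ)) := hψ.hasCompactSupport
  have hψ0 : ∀ z : ℝ × EuclideanSpace ℝ (Fin 3), z ∉ tsupport (uncurry ψ) →
      ψ z.1 z.2 = 0 ∧ fderiv ℝ (ψ z.1) z.2 = 0 ∧ timeDeriv ψ z.1 z.2 = 0 := fun z hz =>
    ⟨(image_eq_zero_of_notMem_tsupport hz : uncurry ψ z = 0),
      IsSpaceTimeTestOn.fderiv_slice_eq_zero_of_notMem hz,
      IsSpaceTimeTestOn.timeDeriv_eq_zero_of_notMem hz⟩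
  have hA0 : ∀ z, z ∉ tsupport (uncurry ψ) → A z = 0 := fun z hz => by
    simp only [hA, (hψ0 z hz).1, (hψ0 z hz).2.1, (hψ0 z hz).2.2, inner_zero_right,
      frobeniusInner_zero_right, sub_zero, add_zero]
  have hB0 : ∀ z, z ∉ tsupport (uncurry ψ) → B z = 0 := fun z hz => by
    simp only [hB, (hψ0 z hz).1, (hψ0 z hz).2.2, inner_zero_right, add_zero]
  have iA : Integrable A (volume : Measure (ℝ × EuclideanSpace ℝ (Fin 3))) :=
    cA.integrable_of_hasCompactSupport (HasCompactSupport.intro hK hA0)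
  have iB : Integrable B (volume : Measure (ℝ × EuclideanSpace ℝ (Fin 3))) :=
    cB.integrable_of_hasCompactSupport (HasCompactSupport.intro hK hB0)
  -- pointwise in `s`: `L s + ∫ A(s, ·) = ∫ B(s, ·)`
  have hpt : ∀ s, BradshawTsai2017.lerayPairing W s (ψ s) =
      (∫ y, B (s, y)) - ∫ y, A (s, y) := by
    intro s
    have h := BradshawTsai2017.lerayPairing_add_integral_eq hW hψ1 hR s
    simp only [hA, hB]
    linarith
  -- `∫∫ B = 0`: for each `y`, `B(·, y)` is the derivative of the compactly supported
  -- `s ↦ ⟪W s y, ψ s y⟫`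
  have hBy : ∀ y, ∫ s, B (s, y) = 0 := by
    intro y
    have hderiv : ∀ s, HasDerivAt (fun s => ⟪W s y, ψ s y⟫) (B (s, y)) s := by
      intro s
      have h1 : HasDerivAt (fun s => W s y) (timeDeriv W s y) s := by
        rw [BradshawTsai2017.timeDeriv_eq_fderiv_uncurry hW]
        exact BradshawTsai2017.hasDerivAt_profile_time hW s y
      have h2 : HasDerivAt (fun s => ψ s y) (timeDeriv ψ s y) s := by
        rw [BradshawTsai2017.timeDeriv_eq_fderiv_uncurry hψ1]
        exact BradshawTsai2017.hasDerivAt_profile_time hψ1 s y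
      have h := h1.inner ℝ h2
      simp only [hB]
      convert h using 1
    obtain ⟨a, b, hab⟩ := hψ.exists_time_support
    have hf0 : ∀ s, s ∉ Icc a b → ⟪W s y, ψ s y⟫ = 0 := fun s hs => by
      rw [show ψ s y = (ψ s) y from rfl, hab s hs]; simp
    have hKs : IsCompact (Icc a b) := isCompact_Icc
    have hfc : Continuous fun s => ⟪W s y, ψ s y⟫ :=
      (cW.comp (continuous_id.prodMk continuous_const)).inner
        (cψ.comp (continuous_id.prodMk continuous_const))
    have hfi : Integrable (fun s => ⟪W s y, ψ s y⟫) (volume : Measure ℝ) :=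
      hfc.integrable_of_hasCompactSupport (HasCompactSupport.intro hKs hf0)
    have hB'c : Continuous fun s => B (s, y) := cB.comp (continuous_id.prodMk continuous_const)
    have hB'0 : ∀ s, s ∉ Icc a b → B (s, y) = 0 := by
      intro s hs
      -- outside the time support all of `ψ s`, `∂ₛψ s` vanish
      have h1 : ψ s = 0 := hab s hs
      have ho : IsOpen (Icc a b)ᶜ := isClosed_Icc.isOpen_compl
      have hev : (fun τ => ψ τ y) =ᶠ[𝓝 s] fun _ => (0 : EuclideanSpace ℝ (Fin 3)) := by
        filter_upwards [ho.mem_nhds hs] with τ hτ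
        rw [show ψ τ y = (ψ τ) y from rfl, hab τ hτ]; rfl
      have h2 : timeDeriv ψ s y = 0 := by
        rw [timeDeriv, hev.deriv_eq, deriv_const]
      simp only [hB, h2, show ψ s y = 0 by rw [show ψ s y = (ψ s) y from rfl, h1]; rfl,
        inner_zero_right, add_zero]
    have hB'i : Integrable (fun s => B (s, y)) (volume : Measure ℝ) :=
      hB'c.integrable_of_hasCompactSupport (HasCompactSupport.intro hKs hB'0)
    exact integral_eq_zero_of_hasDerivAt_of_integrable hderiv hB'i hfi
  have hBB : ∫ z, B z = 0 := by
    rw [Measure.volume_eq_prod, integral_prod _ (by rwa [← Measure.volume_eq_prod])]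
    have hswap := integral_integral_swap (f := fun s y => B (s, y))
      (by rwa [← Measure.volume_eq_prod] : Integrable (uncurry fun s y => B (s, y))
        ((volume : Measure ℝ).prod (volume : Measure (EuclideanSpace ℝ (Fin 3)))))
    show ∫ s, ∫ y, B (s, y) = 0
    rw [hswap]
    simp only [hBy, integral_zero]
  -- assemble
  have eA : ∫ s, ∫ y, A (s, y) = ∫ z, A z := by
    rw [Measure.volume_eq_prod, integral_prod _ (by rwa [← Measure.volume_eq_prod])]
  have eB : ∫ s, ∫ y, B (s, y) = ∫ z, B z := by
    rw [Measure.volume_eq_prod, integral_prod _ (by rwa [← Measure.volume_eq_prod])]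
  calc ∫ s, BradshawTsai2017.lerayPairing W s (ψ s)
      = ∫ s, ((∫ y, B (s, y)) - ∫ y, A (s, y)) := integral_congr_ae (ae_of_all _ hpt)
    _ = (∫ s, ∫ y, B (s, y)) - ∫ s, ∫ y, A (s, y) := by
        refine integral_sub ?_ ?_
        · have h := iB.integral_prod_left
          exact h
        · have h := iA.integral_prod_left
          exact h
    _ = -∫ z, A z := by rw [eA, eB, hBB, zero_sub]

end LerayLine


end Literature.Analysis.FluidPDE

end
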